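import Summits.Ventures.PercRepro.SubdivisionLift

/-!
# The subdivision law: the partition law of a subdivision is that of the base graph

For every marked multigraph `H`, family of path lengths `ℓ` and weight vector `p` on the
subdivision, and for every partition event of marks among the vertices of `H`,

  `prob p ((H.subdivision ℓ).partitionEvent (Sum.inl ∘ μ) rgs)
      = prob (pathProd ℓ p) (H.partitionEvent μ rgs)`

(`prob_partitionEvent_subdivision`): a path behaves like one edge whose weight is the product of
the weights along it. The proof runs the far-end series chain of `SubdivisionC005.lean` for
arbitrary marks (`prob_partitionEvent_subdivStage`), re-attaches the dead edges
(`prob_partitionEvent_congr_of_live`), and identifies the lift `subdivLift H ℓ` with `H`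
(`prob_partitionEvent_subdivLift`): a configuration of positive lifted weight closes every
non-`0` edge, so it is the extension `extend0` of a configuration of `H`, with the same weight
(`weight_subdivLiftWeight_extend0`) and the same connectivity between `inl` vertices
(`conn_subdivLift_iff`).

Consequently EVERY statement about the partition law transfers from `H` to its subdivisions:
`C005At_subdivision_iff` (C-005 for the subdivision at `p` ⇔ C-005 for `H` at the path products)
is the instance for C-005.
-/

namespace PercRepro

namespace MultiGraph

open Finset

section Lift

variable {V₀ E₀ : Type} {H : MultiGraph V₀ E₀} {ℓ : E₀ → ℕ}

/-- The restriction of a configuration of the subdivision edge type to the `0`-edges. -/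
def restrict0 (ℓ : E₀ → ℕ) (ω : Config (SubdivEdge ℓ)) : Config E₀ := fun e => ω ⟨e, 0⟩

/-- The extension of a configuration of the base graph: every non-`0` edge closed. -/
def extend0 (ℓ : E₀ → ℕ) (ω₀ : Config E₀) : Config (SubdivEdge ℓ) :=
  fun x => if (x.2 : ℕ) = 0 then ω₀ x.1 else false

/-- Restricting an extension gives the configuration back. -/
theorem restrict0_extend0 (ω₀ : Config E₀) : restrict0 ℓ (extend0 ℓ ω₀) = ω₀ := by
  funext e
  simp [restrict0, extend0]

/-- A configuration closing every non-`0` edge is the extension of its restriction. -/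
theorem extend0_restrict0 {ω : Config (SubdivEdge ℓ)}
    (h : ∀ x : SubdivEdge ℓ, (x.2 : ℕ) ≠ 0 → ω x = false) : extend0 ℓ (restrict0 ℓ ω) = ω := by
  funext x
  obtain ⟨e, i⟩ := x
  by_cases hi : i = 0
  · subst hi
    simp [extend0, restrict0]
  · have hi' : (i : ℕ) ≠ 0 := fun h' => hi (Fin.ext h')
    simp [extend0, hi', h ⟨e, i⟩ hi']

/-- The extension is injective. -/
theorem extend0_injective : Function.Injective (extend0 ℓ) := fun a b h => by
  rw [← restrict0_extend0 (ℓ := ℓ) a, ← restrict0_extend0 (ℓ := ℓ) b, h]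

/-- Open adjacency of the lift from an `inl` vertex lands on an `inl` vertex and is open
adjacency of the base graph at the restricted configuration. -/
theorem openAdj_subdivLift_inl {ω : Config (SubdivEdge ℓ)} {u : V₀} {b : V₀ ⊕ (E₀ × ℕ)}
    (h : (subdivLift H ℓ).OpenAdj ω (Sum.inl u) b) :
    ∃ v, b = Sum.inl v ∧ H.OpenAdj (restrict0 ℓ ω) u v := by
  obtain ⟨⟨e, i⟩, hx, hend⟩ := h
  by_cases hi : i = 0
  · subst hi
    simp only [subdivLift_fst_zero, subdivLift_snd_zero] at hend
    rcases hend with ⟨h1, h2⟩ | ⟨h1, h2⟩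
    · exact ⟨H.snd e, h2.symm, e, hx, Or.inl ⟨Sum.inl_injective h1, rfl⟩⟩
    · exact ⟨H.fst e, h1.symm, e, hx, Or.inr ⟨rfl, Sum.inl_injective h2⟩⟩
  · exfalso
    simp [subdivLift, hi] at hend

/-- Connectivity of the lift from an `inl` vertex stays among the `inl` vertices and is
connectivity of the base graph. -/
theorem conn_subdivLift_inl {ω : Config (SubdivEdge ℓ)} {u : V₀} {b : V₀ ⊕ (E₀ × ℕ)}
    (h : (subdivLift H ℓ).Conn ω (Sum.inl u) b) :
    ∃ v, b = Sum.inl v ∧ H.Conn (restrict0 ℓ ω) u v := by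
  unfold Conn at h
  induction h with
  | refl => exact ⟨u, rfl, Relation.ReflTransGen.refl⟩
  | tail _ hadj ih =>
    obtain ⟨w, rfl, hw⟩ := ih
    obtain ⟨v, rfl, hv⟩ := openAdj_subdivLift_inl hadj
    exact ⟨v, rfl, Relation.ReflTransGen.tail hw hv⟩

/-- Two `inl` vertices are connected in the lift exactly when they are connected in the base
graph at the restricted configuration. -/
theorem conn_subdivLift_iff (ω : Config (SubdivEdge ℓ)) (u v : V₀) :
    (subdivLift H ℓ).Conn ω (Sum.inl u) (Sum.inl v) ↔ H.Conn (restrict0 ℓ ω) u v := by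
  constructor
  · intro h
    obtain ⟨v', hv', h'⟩ := conn_subdivLift_inl h
    cases Sum.inl_injective hv'
    exact h'
  · intro h
    refine Relation.ReflTransGen.lift (r := H.OpenAdj (restrict0 ℓ ω))
      (p := (subdivLift H ℓ).OpenAdj ω) Sum.inl ?_ u v h
    rintro a b ⟨e, he, hab⟩
    refine ⟨⟨e, 0⟩, he, ?_⟩
    simp only [subdivLift_fst_zero, subdivLift_snd_zero]
    rcases hab with ⟨h1, h2⟩ | ⟨h1, h2⟩
    · exact Or.inl ⟨by rw [h1], by rw [h2]⟩
    · exact Or.inr ⟨by rw [h1], by rw [h2]⟩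

/-- The partition events of the lift for marks among the vertices of `H`. -/
theorem mem_partitionEvent_subdivLift_iff (ω : Config (SubdivEdge ℓ)) {k : ℕ} (μ : Fin k → V₀)
    (rgs : Fin k → ℕ) :
    ω ∈ (subdivLift H ℓ).partitionEvent (Sum.inl ∘ μ) rgs ↔
      restrict0 ℓ ω ∈ H.partitionEvent μ rgs := by
  simp only [partitionEvent, Set.mem_setOf_eq, Function.comp, conn_subdivLift_iff]

variable [Fintype E₀]

/-- The lifted weight of a configuration opening a non-`0` edge is `0`. -/
theorem weight_subdivLiftWeight_eq_zero (q : E₀ → ℝ) {ω : Config (SubdivEdge ℓ)}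
    {x : SubdivEdge ℓ} (hx : (x.2 : ℕ) ≠ 0) (hω : ω x = true) :
    weight (subdivLiftWeight ℓ q) ω = 0 :=
  weight_eq_zero_of_open_of_eq_zero (by simp [subdivLiftWeight, hx]) hω

/-- The lifted weight of an extended configuration is the base weight. -/
theorem weight_subdivLiftWeight_extend0 (q : E₀ → ℝ) (ω₀ : Config E₀) :
    weight (subdivLiftWeight ℓ q) (extend0 ℓ ω₀) = weight q ω₀ := by
  unfold weight
  rw [Fintype.prod_sigma]
  refine prod_congr rfl fun e _ => ?_
  rw [Fin.prod_univ_succ]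
  simp [extend0, subdivLiftWeight]

variable [DecidableEq E₀]

/-- **The partition law of the lift is the partition law of the base graph.** -/
theorem prob_partitionEvent_subdivLift (q : E₀ → ℝ) {k : ℕ} (μ : Fin k → V₀) (rgs : Fin k → ℕ) :
    prob (subdivLiftWeight ℓ q) ((subdivLift H ℓ).partitionEvent (Sum.inl ∘ μ) rgs) =
      prob q (H.partitionEvent μ rgs) := by
  classical
  unfold prob
  have hzero : ∀ ω ∈ (univ : Finset (Config (SubdivEdge ℓ))), ω ∉ univ.image (extend0 ℓ) →
      ((subdivLift H ℓ).partitionEvent (Sum.inl ∘ μ) rgs).indicator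
        (weight (subdivLiftWeight ℓ q)) ω = 0 := by
    intro ω _ hω
    have hopen : ∃ x : SubdivEdge ℓ, (x.2 : ℕ) ≠ 0 ∧ ω x = true := by
      by_contra hcon
      simp only [not_exists, not_and, Bool.not_eq_true] at hcon
      exact hω (mem_image.2 ⟨restrict0 ℓ ω, mem_univ _, extend0_restrict0 hcon⟩)
    obtain ⟨x, hx, hωx⟩ := hopen
    exact Set.indicator_apply_eq_zero.2 fun _ => weight_subdivLiftWeight_eq_zero q hx hωx
  rw [← sum_subset (subset_univ _) hzero, sum_image fun a _ b _ h => extend0_injective h]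
  refine sum_congr rfl fun ω₀ _ => ?_
  simp only [Set.indicator_apply, mem_partitionEvent_subdivLift_iff, restrict0_extend0,
    weight_subdivLiftWeight_extend0]

end Lift

section Chain

variable {V₀ E₀ : Type} {H : MultiGraph V₀ E₀} {ℓ : E₀ → ℕ}

/-- The path products of a probability vector form a probability vector. -/
theorem isProb_pathProd {p : SubdivEdge ℓ → ℝ} (hp : IsProb p) : IsProb (pathProd ℓ p) := by
  intro e
  unfold pathProd
  refine ⟨prod_nonneg fun j _ => ?_, prod_le_one (fun j _ => ?_) fun j _ => ?_⟩ <;>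
    (unfold pathWeight; split_ifs)
  · exact (hp _).1
  · exact zero_le_one
  · exact (hp _).1
  · exact zero_le_one
  · exact (hp _).2
  · exact le_rfl

variable [Fintype E₀] [DecidableEq E₀]

/-- One far-end series step of the subdivision leaves every partition probability of marks among
the vertices of `H` unchanged. -/
theorem prob_partitionEvent_subdivStage_step (p : SubdivEdge ℓ → ℝ) {m : E₀ → ℕ} {e : E₀} {j : ℕ}
    (hj : m e + (j + 1) = ℓ e) {k : ℕ} (μ : Fin k → V₀) (rgs : Fin k → ℕ) :
    prob (subdivWeight ℓ p m) ((subdivStage H ℓ m).partitionEvent (Sum.inl ∘ μ) rgs) =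
      prob (subdivWeight ℓ p (Function.update m e (m e + 1)))
        ((subdivStage H ℓ (Function.update m e (m e + 1))).partitionEvent (Sum.inl ∘ μ) rgs) := by
  have h := (isSeries_subdivStage (H := H) hj).prob_partitionEvent (subdivWeight ℓ p m)
    (m := Sum.inl ∘ μ) (fun i => by simp) rgs
  rwa [seriesGraph_subdivStage hj, serWeight_subdivWeight p hj] at h

/-- The whole far-end chain leaves every partition probability of marks among the vertices of
`H` unchanged (induction on the number of steps). -/
theorem prob_partitionEvent_subdivStage (p : SubdivEdge ℓ → ℝ) {k : ℕ} (μ : Fin k → V₀)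
    (rgs : Fin k → ℕ) (m : E₀ → ℕ) (hm : ∀ e, m e ≤ ℓ e) :
    prob (subdivWeight ℓ p 0) ((subdivStage H ℓ 0).partitionEvent (Sum.inl ∘ μ) rgs) =
      prob (subdivWeight ℓ p m) ((subdivStage H ℓ m).partitionEvent (Sum.inl ∘ μ) rgs) := by
  suffices h : ∀ n (m : E₀ → ℕ), ∑ e, m e = n → (∀ e, m e ≤ ℓ e) →
      prob (subdivWeight ℓ p 0) ((subdivStage H ℓ 0).partitionEvent (Sum.inl ∘ μ) rgs) =
        prob (subdivWeight ℓ p m) ((subdivStage H ℓ m).partitionEvent (Sum.inl ∘ μ) rgs) from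
    h _ m rfl hm
  intro n
  induction n with
  | zero =>
    intro m hsum _
    have hm0 : m = 0 := by
      funext e
      have h := single_le_sum (fun i _ => Nat.zero_le (m i)) (mem_univ e)
      rw [hsum] at h
      exact Nat.le_zero.1 h
    subst hm0
    rfl
  | succ n ih =>
    intro m hsum hm
    obtain ⟨e, he⟩ : ∃ e, m e ≠ 0 := by
      by_contra h
      simp only [ne_eq, not_exists, not_not] at h
      rw [sum_eq_zero (fun e _ => h e)] at hsum
      exact Nat.succ_ne_zero n hsum.symm
    set m' := Function.update m e (m e - 1) with hm'
    have hm'e : m' e = m e - 1 := Function.update_self ..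
    have hsum' : ∑ x, m' x = n := by
      rw [hm', sum_update_of_mem (mem_univ e), sdiff_singleton_eq_erase]
      rw [← add_sum_erase univ m (mem_univ e)] at hsum
      omega
    have hm'le : ∀ x, m' x ≤ ℓ x := by
      intro x
      rw [hm', Function.update_apply]
      split_ifs with hx
      · subst hx
        exact (Nat.sub_le _ _).trans (hm _)
      · exact hm x
    have hstep := prob_partitionEvent_subdivStage_step (H := H) p (m := m') (e := e)
      (j := ℓ e - m e) (by have := hm e; omega) μ rgs
    have hmm : Function.update m' e (m' e + 1) = m := by
      funext x
      rw [Function.update_apply]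
      split_ifs with hx
      · subst hx
        rw [hm'e]
        omega
      · rw [hm', Function.update_of_ne hx]
    rw [hmm] at hstep
    rw [ih m' hsum' hm'le, hstep]

/-- **THE SUBDIVISION LAW**: for marks among the vertices of `H`, the partition law of
`H.subdivision ℓ` at `p` is the partition law of `H` at the path products `pathProd ℓ p`. -/
theorem prob_partitionEvent_subdivision (H : MultiGraph V₀ E₀) (ℓ : E₀ → ℕ)
    (p : SubdivEdge ℓ → ℝ) {k : ℕ} (μ : Fin k → V₀) (rgs : Fin k → ℕ) :
    prob p ((H.subdivision ℓ).partitionEvent (Sum.inl ∘ μ) rgs) =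
      prob (pathProd ℓ p) (H.partitionEvent μ rgs) := by
  have h1 : prob p ((H.subdivision ℓ).partitionEvent (Sum.inl ∘ μ) rgs) =
      prob (subdivWeight ℓ p ℓ) ((subdivStage H ℓ ℓ).partitionEvent (Sum.inl ∘ μ) rgs) := by
    have h := prob_partitionEvent_subdivStage (H := H) p μ rgs ℓ fun e => le_rfl
    rwa [subdivStage_zero, subdivWeight_zero] at h
  rw [h1, subdivWeight_top, prob_partitionEvent_congr_of_live _
    (subdivStage_top_agree H ℓ (pathProd ℓ p)) (Sum.inl ∘ μ) rgs, prob_partitionEvent_subdivLift]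

/-- **C-005 for a subdivision is C-005 for the base graph at the path products.** -/
theorem C005At_subdivision_iff (H : MultiGraph V₀ E₀) (ℓ : E₀ → ℕ) (p : SubdivEdge ℓ → ℝ)
    (a b c d : V₀) :
    (H.subdivision ℓ).C005At p (Sum.inl a) (Sum.inl b) (Sum.inl c) (Sum.inl d) ↔
      H.C005At (pathProd ℓ p) a b c d := by
  have hμ : (![Sum.inl a, Sum.inl b, Sum.inl c, Sum.inl d] : Fin 4 → V₀ ⊕ (E₀ × ℕ)) =
      Sum.inl ∘ ![a, b, c, d] := by
    funext i
    fin_cases i <;> rfl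
  unfold C005At
  rw [hμ]
  simp only [prob_partitionEvent_subdivision]

end Chain

end MultiGraph

end PercRepro
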